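import Summits.ResolutionOfSingularities.ResolutionOfSingularities.Theorems.FrobeniusLadderFInjectiveMacaulayficationWildPinchCylinder
import Literature.AlgebraicGeometry.Resolution.MvPolynomialKillVars
import Literature.AlgebraicGeometry.Resolution.MarkedIdeals
import Literature.AlgebraicGeometry.Resolution.StalkIdealGenerization
import Mathlib.AlgebraicGeometry.Noetherian
import Mathlib.RingTheory.Ideal.KrullsHeightTheorem
import Mathlib.AlgebraicGeometry.AffineScheme
import Mathlib.AlgebraicGeometry.IdealSheaf.Basic
import Mathlib.AlgebraicGeometry.Morphisms.ClosedImmersion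
import Mathlib.RingTheory.Ideal.Height
import Mathlib.RingTheory.IntegralClosure.IntegrallyClosed
import HarnessLib

/-!
# The wild pinch cylinder as a scheme: points, the t-axis centre `I_C`, the pinch surface `B` (witness-2 DATA (d1)/(d2) for the
# negatives of (T3)/(T3-fin)/(T3′)/(T3′-pow); crux `FInjectiveMacaulayfication` stmt-ResolutionOfSingularities-15315, chain w45a; res-L1-w45a-tri-2
# KILL 2, res-L1-w45a-plan-1 R16.41 (2) / R16.42 (3) / R16.45 (3); seat res-L1-w45a-stub-3 g6)

[OURS · L1 W4.5a] Support file (`--supports stmt-ResolutionOfSingularities-15315 --as helper`); NOT a statement of any manuscript; theorem-only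
(no `def`, no named fact, unconditional); AI-written (AI review is weaker than expert review). SETTING (`WildPinchCylinder`): `R = k[X₀,…,X₄]/(F)`,
`F = X₂² + X₀²X₁X₂ + X₀X₁²`, `X₁ := Spec R`, primes `𝔮_S := (X̄_i : i ∈ S)` (`0, 2 ∈ S`). Cast: `b` = origin `𝔮_{01234}` (closed, §2); `C` = t-axis
`V(u,y,v₁,v₂)`, generic point `𝔮_{0234}`, ideal sheaf **`I_C := Scheme.IdealSheafData.ofIdealTop ((𝔮_{0234}).map (Scheme.ΓSpecIso (.of R)).inv.hom)`**
(the presentation consumed by the (d4) file `…WildPinchCylinderAxisGood`; support = `{𝔮_{0234} ≤ 𝔭_x}`, off `b` on it `t̄` is a unit so the local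
rings are regular, §3); `B` = pinch surface `V(u,t,y)`, generic point `η_B = 𝔮_{012}`, `C ∩ B = {b}` (§3); `B` as the closed subscheme
`Spec k[X]/(X₀,X₁,X₂) ≅ 𝔸²` with `i : B ⟶ X₁`, integrally closed stalks (`hnorm`), images of its points (§4); and `hb` (§5): an ideal sheaf `J`
with `b ∈ supp J` and `supp J ∩ B ⊆ {b}` restricts to a NON-principal ideal of `𝒪_{B,b}` (Krull). [folklore; cite: StacksProject, Tag 01J7]
-/

-- single-problem summit: the doubled namespace component is forced
set_option linter.dupNamespace false

noncomputable section

open MvPolynomial IsLocalRing AlgebraicGeometry CategoryTheory Literature.AlgebraicGeometry.Resolution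

namespace Summit.ResolutionOfSingularities.ResolutionOfSingularities.Theorems.FInjectiveMacaulayfication.WildPinchCylinderAxis

open Summit.ResolutionOfSingularities.ResolutionOfSingularities.Theorems.FInjectiveMacaulayfication

/-! ## §1 Plumbing on `Spec A` -/
section Plumbing

variable {A : Type} [CommRing A]

/-- **Support of the ideal sheaf of an ideal**: `x ∈ supp (𝔞·𝒪_{Spec A}) ↔ 𝔞 ≤ 𝔭_x`. [plumbing] -/
theorem mem_support_ofIdealTop_map_iff (𝔞 : Ideal A) (x : Spec (.of A)) :
    x ∈ ((Scheme.IdealSheafData.ofIdealTop (𝔞.map (Scheme.ΓSpecIso (.of A)).inv.hom) :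
        (Spec (.of A)).IdealSheafData).support : Set (Spec (.of A))) ↔ 𝔞 ≤ x.asIdeal := by
  rw [Scheme.IdealSheafData.coe_support_ofIdealTop, Ideal.map, Scheme.zeroLocus_span, Spec_zeroLocus_eq_zeroLocus]
  change x ∈ PrimeSpectrum.zeroLocus (𝔞 : Set A) ↔ _
  exact (PrimeSpectrum.mem_zeroLocus x (𝔞 : Set A)).trans SetLike.coe_subset_coe

/-- Specialisation in `Spec A` is inclusion of primes. [plumbing] -/
theorem specializes_iff_le (x y : Spec (.of A)) : x ⤳ y ↔ x.asIdeal ≤ y.asIdeal :=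
  (PrimeSpectrum.le_iff_specializes x y).symm.trans (PrimeSpectrum.asIdeal_le_asIdeal x y).symm

/-- `stalkIdeal I x = ⊤ ↔ x ∉ supp I`. [plumbing] -/
theorem stalkIdeal_eq_top_iff {X : Scheme.{0}} (I : X.IdealSheafData) (x : X) :
    stalkIdeal I x = ⊤ ↔ x ∉ (I.support : Set X) := by
  change _ ↔ x ∉ I.support
  rw [mem_support_iff_stalkIdeal_le]
  constructor
  · intro h hle
    rw [h] at hle
    exact (maximalIdeal.isMaximal (X.presheaf.stalk x)).ne_top (top_le_iff.mp hle)
  · intro h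
    by_contra hne
    exact h (IsLocalRing.le_maximalIdeal hne)

end Plumbing

/-! ## §2 The primes `𝔮_S`, the origin `b` -/
section Points

variable (k : Type) [Field k] (F : MvPolynomial (Fin 5) k) (hF : F = X 2 ^ 2 + X 0 ^ 2 * X 1 * X 2 + X 0 * X 1 ^ 2)

/-- **`(X₀,…,X₄)` is a maximal ideal of `k[X₀,…,X₄]`** (the quotient is `k`). [folklore] -/
theorem isMaximal_span_X_univ :
    (Ideal.span (MvPolynomial.X '' (Set.univ : Set (Fin 5)) : Set (MvPolynomial (Fin 5) k))).IsMaximal := by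
  refine Ideal.Quotient.maximal_of_isField _ ?_
  haveI : IsEmpty {j : Fin 5 // j ∉ (Set.univ : Set (Fin 5))} := ⟨fun j => j.2 (Set.mem_univ _)⟩
  let e := (MvPolynomial.quotientSpanXEquiv (R := k) (Set.univ : Set (Fin 5))).toMulEquiv.trans
    (MvPolynomial.isEmptyAlgEquiv k {j : Fin 5 // j ∉ (Set.univ : Set (Fin 5))}).toMulEquiv
  exact MulEquiv.isField (Field.toIsField k) e

include hF in
/-- **The origin `𝔮_{01234}` is a maximal ideal of `R`.** [folklore] -/
theorem isMaximal_P_univ :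
    ((Ideal.span (MvPolynomial.X '' (Set.univ : Set (Fin 5)) : Set (MvPolynomial (Fin 5) k))).map
      (Ideal.Quotient.mk (Ideal.span {F}))).IsMaximal := by
  rcases Ideal.map_eq_top_or_isMaximal_of_surjective (Ideal.Quotient.mk (Ideal.span {F})) Ideal.Quotient.mk_surjective
    (isMaximal_span_X_univ k) with h | h
  · exact absurd h (WildPinchCylinder.isPrime_map_span_X k F hF (S := Set.univ) (Set.mem_univ _) (Set.mem_univ _)).1.ne_top
  · exact h

include hF in
/-- **A prime of `R` containing `𝔮_S` and `𝔮_T` with `S ∪ T = {0,…,4}` is the origin.** [folklore] -/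
theorem eq_P_univ_of_le {S T : Set (Fin 5)} (hST : S ∪ T = Set.univ) (Q : Ideal (MvPolynomial (Fin 5) k ⧸ Ideal.span {F})) [Q.IsPrime]
    (hS : (Ideal.span (MvPolynomial.X '' S : Set (MvPolynomial (Fin 5) k))).map (Ideal.Quotient.mk (Ideal.span {F})) ≤ Q)
    (hT : (Ideal.span (MvPolynomial.X '' T : Set (MvPolynomial (Fin 5) k))).map (Ideal.Quotient.mk (Ideal.span {F})) ≤ Q) :
    Q = (Ideal.span (MvPolynomial.X '' (Set.univ : Set (Fin 5)) : Set (MvPolynomial (Fin 5) k))).map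
      (Ideal.Quotient.mk (Ideal.span {F})) := by
  refine ((isMaximal_P_univ k F hF).eq_of_le ‹Q.IsPrime›.ne_top ?_).symm
  rw [← hST, Set.image_union, Ideal.span_union, Ideal.map_sup]
  exact sup_le hS hT

end Points

/-! ## §3 The t-axis centre `I_C` and the pinch surface `B` inside `X₁ = Spec R` -/
section Axis

variable (k : Type) [Field k] (F : MvPolynomial (Fin 5) k) (hF : F = X 2 ^ 2 + X 0 ^ 2 * X 1 * X 2 + X 0 * X 1 ^ 2)

include hF in
/-- **Off the origin, `t̄` is a unit along `C`:** if `𝔮_{0234} ≤ 𝔭_x` and `𝔭_x ≠ 𝔮_{01234}` then `t̄ = X̄₁ ∉ 𝔭_x` — so `𝒪_{X₁,x}` is a REGULAR local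
ring there (`WildPinchCylinder.isRegularLocalRing_of_X1_not_mem`). [folklore] -/
theorem X1_not_mem_of_P0234_le (x : Spec (.of (MvPolynomial (Fin 5) k ⧸ Ideal.span {F})))
    (hx : (Ideal.span (MvPolynomial.X '' ({0, 2, 3, 4} : Set (Fin 5)) : Set (MvPolynomial (Fin 5) k))).map
      (Ideal.Quotient.mk (Ideal.span {F})) ≤ x.asIdeal)
    (hxb : x.asIdeal ≠ (Ideal.span (MvPolynomial.X '' (Set.univ : Set (Fin 5)) : Set (MvPolynomial (Fin 5) k))).map
      (Ideal.Quotient.mk (Ideal.span {F}))) :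
    Ideal.Quotient.mk (Ideal.span {F}) (X 1) ∉ x.asIdeal := by
  intro h1
  refine hxb (eq_P_univ_of_le k F hF (S := ({0, 2, 3, 4} : Set (Fin 5))) (T := ({1} : Set (Fin 5))) ?_ x.asIdeal hx ?_)
  · ext i; fin_cases i <;> simp
  · rw [Set.image_singleton, Ideal.map_span, Set.image_singleton, Ideal.span_singleton_le_iff_mem]
    exact h1

include hF in
/-- **`C ∩ B = {b}`**: a prime containing `𝔮_{012}` (i.e. a point of `B`) and `𝔮_{0234}` (i.e. of `C`) is the origin. [folklore] -/
theorem eq_origin_of_B_of_C (x : Spec (.of (MvPolynomial (Fin 5) k ⧸ Ideal.span {F})))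
    (hB : (Ideal.span (MvPolynomial.X '' ({0, 1, 2} : Set (Fin 5)) : Set (MvPolynomial (Fin 5) k))).map
      (Ideal.Quotient.mk (Ideal.span {F})) ≤ x.asIdeal)
    (hC : (Ideal.span (MvPolynomial.X '' ({0, 2, 3, 4} : Set (Fin 5)) : Set (MvPolynomial (Fin 5) k))).map
      (Ideal.Quotient.mk (Ideal.span {F})) ≤ x.asIdeal) :
    x.asIdeal = (Ideal.span (MvPolynomial.X '' (Set.univ : Set (Fin 5)) : Set (MvPolynomial (Fin 5) k))).map
      (Ideal.Quotient.mk (Ideal.span {F})) :=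
  eq_P_univ_of_le k F hF (S := ({0, 1, 2} : Set (Fin 5))) (T := ({0, 2, 3, 4} : Set (Fin 5))) (by ext i; fin_cases i <;> simp) x.asIdeal hB hC

/-- **The ideal sheaf `I_C` of the `t`-axis: support.** `x ∈ supp I_C ↔ 𝔮_{0234} ≤ 𝔭_x`; in particular the origin `b` and the generic point
`γ_C` of `C` lie in `supp I_C`. [plumbing] -/
theorem mem_support_IC_iff (x : Spec (.of (MvPolynomial (Fin 5) k ⧸ Ideal.span {F}))) :
    x ∈ ((Scheme.IdealSheafData.ofIdealTop (((Ideal.span (MvPolynomial.X '' ({0, 2, 3, 4} : Set (Fin 5)) :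
        Set (MvPolynomial (Fin 5) k))).map (Ideal.Quotient.mk (Ideal.span {F}))).map
          (Scheme.ΓSpecIso (.of (MvPolynomial (Fin 5) k ⧸ Ideal.span {F}))).inv.hom) :
      (Spec (.of (MvPolynomial (Fin 5) k ⧸ Ideal.span {F}))).IdealSheafData).support :
        Set (Spec (.of (MvPolynomial (Fin 5) k ⧸ Ideal.span {F})))) ↔
      (Ideal.span (MvPolynomial.X '' ({0, 2, 3, 4} : Set (Fin 5)) : Set (MvPolynomial (Fin 5) k))).map
        (Ideal.Quotient.mk (Ideal.span {F})) ≤ x.asIdeal :=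
  mem_support_ofIdealTop_map_iff _ x

include hF in
/-- **`I_C` is the unit ideal at every point of `B ∖ {b}`** (`C ∩ B = {b}`): for `𝔮_{012} ≤ 𝔭_y ≠ 𝔮_{01234}`, `stalkIdeal I_C y = ⊤`; hence
any ideal sheaf `J` with `stalkIdeal J y = (stalkIdeal I_C y) ^ n` there has `y ∉ supp J`. [plumbing] -/
theorem not_mem_support_of_eq_IC_pow_on_B (J : (Spec (.of (MvPolynomial (Fin 5) k ⧸ Ideal.span {F}))).IdealSheafData) (n : ℕ)
    (y : Spec (.of (MvPolynomial (Fin 5) k ⧸ Ideal.span {F})))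
    (hB : (Ideal.span (MvPolynomial.X '' ({0, 1, 2} : Set (Fin 5)) : Set (MvPolynomial (Fin 5) k))).map
      (Ideal.Quotient.mk (Ideal.span {F})) ≤ y.asIdeal)
    (hyb : y.asIdeal ≠ (Ideal.span (MvPolynomial.X '' (Set.univ : Set (Fin 5)) : Set (MvPolynomial (Fin 5) k))).map
      (Ideal.Quotient.mk (Ideal.span {F})))
    (hJ : stalkIdeal J y =
      stalkIdeal (Scheme.IdealSheafData.ofIdealTop (((Ideal.span (MvPolynomial.X '' ({0, 2, 3, 4} : Set (Fin 5)) :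
        Set (MvPolynomial (Fin 5) k))).map (Ideal.Quotient.mk (Ideal.span {F}))).map
          (Scheme.ΓSpecIso (.of (MvPolynomial (Fin 5) k ⧸ Ideal.span {F}))).inv.hom)) y ^ n) :
    y ∉ (J.support : Set (Spec (.of (MvPolynomial (Fin 5) k ⧸ Ideal.span {F})))) := by
  have hC : stalkIdeal (Scheme.IdealSheafData.ofIdealTop (((Ideal.span (MvPolynomial.X '' ({0, 2, 3, 4} : Set (Fin 5)) :
        Set (MvPolynomial (Fin 5) k))).map (Ideal.Quotient.mk (Ideal.span {F}))).map
          (Scheme.ΓSpecIso (.of (MvPolynomial (Fin 5) k ⧸ Ideal.span {F}))).inv.hom)) y = ⊤ := by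
    rw [stalkIdeal_eq_top_iff, mem_support_IC_iff k F]
    exact fun hle => hyb (eq_origin_of_B_of_C k F hF y hB hle)
  rw [← stalkIdeal_eq_top_iff, hJ, hC, Ideal.top_pow]

end Axis

/-! ## §4 The pinch surface as a closed subscheme: `B := Spec k[X]/(X₀,X₁,X₂) ≅ 𝔸²`, `i : B ⟶ X₁` -/
section Surface

variable (k : Type) [Field k] (F : MvPolynomial (Fin 5) k) (hF : F = X 2 ^ 2 + X 0 ^ 2 * X 1 * X 2 + X 0 * X 1 ^ 2)

include hF in
/-- `(F) ≤ (X₀, X₁, X₂)`, so `R → k[X]/(X₀,X₁,X₂)` factors. [folklore] -/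
theorem span_F_le_span_X012 :
    Ideal.span {F} ≤ Ideal.span (MvPolynomial.X '' ({0, 1, 2} : Set (Fin 5)) : Set (MvPolynomial (Fin 5) k)) := by
  rw [Ideal.span_singleton_le_iff_mem]
  exact WildPinchCylinder.F_mem_span_X k F hF (by simp) (by simp)

/-- `D′ = k[X]/(X₀,X₁,X₂)` is a domain. [folklore] -/
theorem isDomain_D' : IsDomain (MvPolynomial (Fin 5) k ⧸ Ideal.span (MvPolynomial.X '' ({0, 1, 2} : Set (Fin 5)) : Set (MvPolynomial (Fin 5) k))) :=
  Literature.AlgebraicGeometry.Resolution.MvPolynomial.isDomain_quotient_span_X (R := k) (τ := Fin 5) _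

/-- `D′ ≅ k[v₁, v₂]` is integrally closed (a UFD). [folklore] -/
theorem isIntegrallyClosed_D' :
    IsIntegrallyClosed (MvPolynomial (Fin 5) k ⧸ Ideal.span (MvPolynomial.X '' ({0, 1, 2} : Set (Fin 5)) : Set (MvPolynomial (Fin 5) k))) :=
  IsIntegrallyClosed.of_equiv
    (Literature.AlgebraicGeometry.Resolution.MvPolynomial.quotientSpanXEquiv (R := k) (τ := Fin 5) ({0, 1, 2} : Set (Fin 5))).toRingEquiv.symm

/-- **`hnorm`: every stalk of `B = Spec D′` is integrally closed** (a localisation of the UFD `D′`). [folklore] -/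
theorem isIntegrallyClosed_stalk_B
    (y : Spec (.of (MvPolynomial (Fin 5) k ⧸ Ideal.span (MvPolynomial.X '' ({0, 1, 2} : Set (Fin 5)) : Set (MvPolynomial (Fin 5) k))))) :
    IsIntegrallyClosed ((Spec (.of (MvPolynomial (Fin 5) k ⧸
      Ideal.span (MvPolynomial.X '' ({0, 1, 2} : Set (Fin 5)) : Set (MvPolynomial (Fin 5) k))))).presheaf.stalk y) := by
  haveI := isDomain_D' k
  haveI := isIntegrallyClosed_D' k
  haveI : IsIntegrallyClosed (Localization.AtPrime y.asIdeal) :=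
    isIntegrallyClosed_of_isLocalization (Localization.AtPrime y.asIdeal) y.asIdeal.primeCompl y.asIdeal.primeCompl_le_nonZeroDivisors
  exact IsIntegrallyClosed.of_equiv (Spec.stalkIso (.of _) y).commRingCatIsoToRingEquiv.symm

include hF in
/-- **`i : B ⟶ X₁` is a closed immersion** (`R → D′` is surjective). [folklore] -/
theorem isClosedImmersion_i :
    IsClosedImmersion (Spec.map (CommRingCat.ofHom (Ideal.Quotient.factor (span_F_le_span_X012 k F hF)))) :=
  IsClosedImmersion.spec_of_surjective _ (by
    simpa using Ideal.Quotient.factor_surjective (span_F_le_span_X012 k F hF))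

include hF in
/-- Pulling an ideal of `D′` back along `φ : R → D′`: `φ⁻¹ 𝔟 = (mk′⁻¹ 𝔟)·R`. [plumbing] -/
theorem comap_factor (𝔟 : Ideal (MvPolynomial (Fin 5) k ⧸ Ideal.span (MvPolynomial.X '' ({0, 1, 2} : Set (Fin 5)) : Set (MvPolynomial (Fin 5) k)))) :
    𝔟.comap (Ideal.Quotient.factor (span_F_le_span_X012 k F hF)) =
      (𝔟.comap (Ideal.Quotient.mk _)).map (Ideal.Quotient.mk (Ideal.span {F})) := by
  rw [← Ideal.map_comap_of_surjective (Ideal.Quotient.mk (Ideal.span {F})) Ideal.Quotient.mk_surjective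
    (𝔟.comap (Ideal.Quotient.factor (span_F_le_span_X012 k F hF))), Ideal.comap_comap, Ideal.Quotient.factor_comp_mk]

/-- For `{0,1,2} ⊆ T`, the image `𝔮′_T` of `(X_i : i ∈ T)` in `D′` is prime and pulls back to `(X_i : i ∈ T)`. [folklore] -/
theorem isPrime_map'_span_X {T : Set (Fin 5)} (hT : ({0, 1, 2} : Set (Fin 5)) ⊆ T) :
    ((Ideal.span (MvPolynomial.X '' T : Set (MvPolynomial (Fin 5) k))).map (Ideal.Quotient.mk
      (Ideal.span (MvPolynomial.X '' ({0, 1, 2} : Set (Fin 5)) : Set (MvPolynomial (Fin 5) k))))).IsPrime ∧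
    ((Ideal.span (MvPolynomial.X '' T : Set (MvPolynomial (Fin 5) k))).map (Ideal.Quotient.mk
      (Ideal.span (MvPolynomial.X '' ({0, 1, 2} : Set (Fin 5)) : Set (MvPolynomial (Fin 5) k))))).comap (Ideal.Quotient.mk _) =
        Ideal.span (MvPolynomial.X '' T : Set (MvPolynomial (Fin 5) k)) := by
  have hker : RingHom.ker (Ideal.Quotient.mk (Ideal.span (MvPolynomial.X '' ({0, 1, 2} : Set (Fin 5)) : Set (MvPolynomial (Fin 5) k)))) ≤
      Ideal.span (MvPolynomial.X '' T : Set (MvPolynomial (Fin 5) k)) := by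
    rw [Ideal.mk_ker]
    exact Ideal.span_mono (Set.image_mono hT)
  haveI : (Ideal.span (MvPolynomial.X '' T : Set (MvPolynomial (Fin 5) k))).IsPrime := by
    haveI := Literature.AlgebraicGeometry.Resolution.MvPolynomial.isDomain_quotient_span_X (R := k) (τ := Fin 5) T
    exact (Ideal.Quotient.isDomain_iff_prime _).mp this
  refine ⟨Ideal.map_isPrime_of_surjective Ideal.Quotient.mk_surjective hker, ?_⟩
  rw [Ideal.comap_map_of_surjective _ Ideal.Quotient.mk_surjective, sup_eq_left]
  rwa [← RingHom.ker_eq_comap_bot]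

include hF in
/-- **`i` maps the point `𝔮′_T` of `B` to the point `𝔮_T` of `X₁`** (`{0,1,2} ⊆ T`). [plumbing] -/
theorem comap_factor_map'_span_X {T : Set (Fin 5)} (hT : ({0, 1, 2} : Set (Fin 5)) ⊆ T) :
    ((Ideal.span (MvPolynomial.X '' T : Set (MvPolynomial (Fin 5) k))).map (Ideal.Quotient.mk
      (Ideal.span (MvPolynomial.X '' ({0, 1, 2} : Set (Fin 5)) : Set (MvPolynomial (Fin 5) k))))).comap
        (Ideal.Quotient.factor (span_F_le_span_X012 k F hF)) =
      (Ideal.span (MvPolynomial.X '' T : Set (MvPolynomial (Fin 5) k))).map (Ideal.Quotient.mk (Ideal.span {F})) := by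
  rw [comap_factor k F hF, (isPrime_map'_span_X k hT).2]

include hF in
/-- **`i` maps the generic point of `B` to `η_B = 𝔮_{012}`.** [plumbing] -/
theorem comap_factor_bot :
    (⊥ : Ideal (MvPolynomial (Fin 5) k ⧸ Ideal.span (MvPolynomial.X '' ({0, 1, 2} : Set (Fin 5)) : Set (MvPolynomial (Fin 5) k)))).comap
        (Ideal.Quotient.factor (span_F_le_span_X012 k F hF)) =
      (Ideal.span (MvPolynomial.X '' ({0, 1, 2} : Set (Fin 5)) : Set (MvPolynomial (Fin 5) k))).map (Ideal.Quotient.mk (Ideal.span {F})) := by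
  rw [comap_factor k F hF, ← RingHom.ker_eq_comap_bot, Ideal.mk_ker]

include hF in
/-- **Every point in the image of `i` lies in `B`**: `𝔮_{012} ≤ φ⁻¹ 𝔟`. [plumbing] -/
theorem P012_le_comap_factor (𝔟 : Ideal (MvPolynomial (Fin 5) k ⧸ Ideal.span (MvPolynomial.X '' ({0, 1, 2} : Set (Fin 5)) : Set (MvPolynomial (Fin 5) k)))) :
    (Ideal.span (MvPolynomial.X '' ({0, 1, 2} : Set (Fin 5)) : Set (MvPolynomial (Fin 5) k))).map (Ideal.Quotient.mk (Ideal.span {F})) ≤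
      𝔟.comap (Ideal.Quotient.factor (span_F_le_span_X012 k F hF)) := by
  rw [← comap_factor_bot k F hF]
  exact Ideal.comap_mono bot_le

/-- **`2 ≤ ht 𝔮′_{01234}` in `D′`** (the chain `⊥ < 𝔮′_{0123} < 𝔮′_{01234}`; `D′ ≅ k[v₁,v₂]`). [folklore] -/
theorem two_le_height_origin_D' :
    (2 : ℕ∞) ≤ ((Ideal.span (MvPolynomial.X '' (Set.univ : Set (Fin 5)) : Set (MvPolynomial (Fin 5) k))).map (Ideal.Quotient.mk
      (Ideal.span (MvPolynomial.X '' ({0, 1, 2} : Set (Fin 5)) : Set (MvPolynomial (Fin 5) k))))).height := by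
  haveI := isDomain_D' k
  have h0123 : ({0, 1, 2} : Set (Fin 5)) ⊆ ({0, 1, 2, 3} : Set (Fin 5)) := by
    intro i hi; simp only [Set.mem_insert_iff, Set.mem_singleton_iff] at hi ⊢; tauto
  haveI hP₁ := (isPrime_map'_span_X k h0123).1
  haveI hP₂ := (isPrime_map'_span_X k (Set.subset_univ ({0, 1, 2} : Set (Fin 5)))).1
  -- `⊥ < 𝔮′_{0123}`: `X̄₃ ≠ 0`
  have hlt₁ : (⊥ : Ideal (MvPolynomial (Fin 5) k ⧸ Ideal.span (MvPolynomial.X '' ({0, 1, 2} : Set (Fin 5)) : Set (MvPolynomial (Fin 5) k)))) <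
      (Ideal.span (MvPolynomial.X '' ({0, 1, 2, 3} : Set (Fin 5)) : Set (MvPolynomial (Fin 5) k))).map (Ideal.Quotient.mk _) := by
    refine bot_lt_iff_ne_bot.mpr fun h => ?_
    have hx : Ideal.Quotient.mk (Ideal.span (MvPolynomial.X '' ({0, 1, 2} : Set (Fin 5)) : Set (MvPolynomial (Fin 5) k))) (X 3) ∈
        (Ideal.span (MvPolynomial.X '' ({0, 1, 2, 3} : Set (Fin 5)) : Set (MvPolynomial (Fin 5) k))).map (Ideal.Quotient.mk _) :=
      Ideal.mem_map_of_mem _ (Ideal.subset_span ⟨3, by simp, rfl⟩)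
    rw [h, Ideal.mem_bot, Ideal.Quotient.eq_zero_iff_mem] at hx
    exact Literature.AlgebraicGeometry.Resolution.MvPolynomial.X_not_mem_span_X (R := k) ({0, 1, 2} : Set (Fin 5)) (j := 3) (by simp) hx
  -- `𝔮′_{0123} < 𝔮′_{01234}`: `X̄₄ ∉ 𝔮′_{0123}`
  have hlt₂ : (Ideal.span (MvPolynomial.X '' ({0, 1, 2, 3} : Set (Fin 5)) : Set (MvPolynomial (Fin 5) k))).map (Ideal.Quotient.mk
        (Ideal.span (MvPolynomial.X '' ({0, 1, 2} : Set (Fin 5)) : Set (MvPolynomial (Fin 5) k)))) <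
      (Ideal.span (MvPolynomial.X '' (Set.univ : Set (Fin 5)) : Set (MvPolynomial (Fin 5) k))).map (Ideal.Quotient.mk _) := by
    refine lt_of_le_of_ne (Ideal.map_mono (Ideal.span_mono (Set.image_mono (Set.subset_univ _)))) fun heq => ?_
    have hx : Ideal.Quotient.mk (Ideal.span (MvPolynomial.X '' ({0, 1, 2} : Set (Fin 5)) : Set (MvPolynomial (Fin 5) k))) (X 4) ∈
        (Ideal.span (MvPolynomial.X '' ({0, 1, 2, 3} : Set (Fin 5)) : Set (MvPolynomial (Fin 5) k))).map (Ideal.Quotient.mk _) := by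
      rw [heq]; exact Ideal.mem_map_of_mem _ (Ideal.subset_span ⟨4, Set.mem_univ _, rfl⟩)
    have hx' : (X 4 : MvPolynomial (Fin 5) k) ∈ Ideal.span (MvPolynomial.X '' ({0, 1, 2, 3} : Set (Fin 5)) : Set (MvPolynomial (Fin 5) k)) := by
      rw [← (isPrime_map'_span_X k h0123).2]; exact Ideal.mem_comap.mpr hx
    exact Literature.AlgebraicGeometry.Resolution.MvPolynomial.X_not_mem_span_X (R := k) ({0, 1, 2, 3} : Set (Fin 5)) (j := 4) (by simp) hx'
  have h1 := Ideal.height_add_one_le_of_lt_of_isPrime hlt₁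
  have h2 := Ideal.height_add_one_le_of_lt_of_isPrime hlt₂
  rw [Ideal.height_bot, zero_add] at h1
  calc (2 : ℕ∞) = 1 + 1 := by norm_num
    _ ≤ _ := add_le_add h1 le_rfl
    _ ≤ _ := h2

end Surface

/-! ## §5 `hb`: an ideal sheaf vanishing at `b` and trivial on `B ∖ {b}` restricts to a NON-principal ideal of `𝒪_{B,b}` -/
section NonPrincipal

variable (k : Type) [Field k] (F : MvPolynomial (Fin 5) k) (hF : F = X 2 ^ 2 + X 0 ^ 2 * X 1 * X 2 + X 0 * X 1 ^ 2)

include hF in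
/-- **`hb` — Krull.** Let `J` be an ideal sheaf on `X₁ = Spec R` with `b ∈ supp J` and `y ∉ supp J` for every point `y ≠ b` of the pinch
surface `B` (`𝔮_{012} ≤ 𝔭_y ≠ 𝔮_{01234}`). Then the stalk at the origin `b_B` of `B = Spec k[X]/(X₀,X₁,X₂)` of the restriction
`J·𝒪_B = J.comap i` is NOT principal: its only prime of `𝒪_{B,b_B}` above it is the maximal ideal (a generisation `ζ` of `b_B` inside
`supp (J·𝒪_B)` maps to a point of `B ∩ supp J`, i.e. to `b`), which has height `dim 𝒪_{B,b_B} ≥ 2`, whereas a prime minimal over a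
principal ideal has height `≤ 1` (Krull). [cite: Matsumura1987, Thm. 13.5] [cite: StacksProject, Tag 01J7] -/
theorem not_exists_stalkIdeal_comap_eq_span (J : (Spec (.of (MvPolynomial (Fin 5) k ⧸ Ideal.span {F}))).IdealSheafData)
    (bB : Spec (.of (MvPolynomial (Fin 5) k ⧸ Ideal.span (MvPolynomial.X '' ({0, 1, 2} : Set (Fin 5)) : Set (MvPolynomial (Fin 5) k)))))
    (hbB : bB.asIdeal = (Ideal.span (MvPolynomial.X '' (Set.univ : Set (Fin 5)) : Set (MvPolynomial (Fin 5) k))).map (Ideal.Quotient.mk _))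
    (hb : (Spec.map (CommRingCat.ofHom (Ideal.Quotient.factor (span_F_le_span_X012 k F hF)))).base bB ∈
      (J.support : Set (Spec (.of (MvPolynomial (Fin 5) k ⧸ Ideal.span {F})))))
    (hoff : ∀ y : Spec (.of (MvPolynomial (Fin 5) k ⧸ Ideal.span {F})),
      (Ideal.span (MvPolynomial.X '' ({0, 1, 2} : Set (Fin 5)) : Set (MvPolynomial (Fin 5) k))).map (Ideal.Quotient.mk (Ideal.span {F})) ≤
        y.asIdeal →
      y.asIdeal ≠ (Ideal.span (MvPolynomial.X '' (Set.univ : Set (Fin 5)) : Set (MvPolynomial (Fin 5) k))).map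
        (Ideal.Quotient.mk (Ideal.span {F})) →
      y ∉ (J.support : Set (Spec (.of (MvPolynomial (Fin 5) k ⧸ Ideal.span {F}))))) :
    ¬ ∃ g : (Spec (.of (MvPolynomial (Fin 5) k ⧸ Ideal.span (MvPolynomial.X '' ({0, 1, 2} : Set (Fin 5)) :
        Set (MvPolynomial (Fin 5) k))))).presheaf.stalk bB,
      stalkIdeal (J.comap (Spec.map (CommRingCat.ofHom (Ideal.Quotient.factor (span_F_le_span_X012 k F hF))))) bB = Ideal.span {g} := by
  haveI := isDomain_D' k
  rintro ⟨g, hg⟩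
  -- names
  let B : Scheme.{0} := Spec (.of (MvPolynomial (Fin 5) k ⧸ Ideal.span (MvPolynomial.X '' ({0, 1, 2} : Set (Fin 5)) :
    Set (MvPolynomial (Fin 5) k))))
  let i : B ⟶ Spec (.of (MvPolynomial (Fin 5) k ⧸ Ideal.span {F})) :=
    Spec.map (CommRingCat.ofHom (Ideal.Quotient.factor (span_F_le_span_X012 k F hF)))
  haveI : IsClosedImmersion i := isClosedImmersion_i k F hF
  let K : B.IdealSheafData := J.comap i
  change stalkIdeal K bB = Ideal.span {g} at hg
  have hi : ∀ y : B, (i.base y).asIdeal = y.asIdeal.comap (Ideal.Quotient.factor (span_F_le_span_X012 k F hF)) := fun y => rfl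
  -- (1) `K_{b_B} ≤ 𝔪`
  have hmemK : bB ∈ K.support := by
    change bB ∈ (J.comap i).support
    rw [Scheme.IdealSheafData.support_comap]
    exact hb
  have hle : stalkIdeal K bB ≤ maximalIdeal (B.presheaf.stalk bB) := (mem_support_iff_stalkIdeal_le K bB).mp hmemK
  -- (2) the maximal ideal is a minimal prime of `K_{b_B} = (g)`
  have hmin : maximalIdeal (B.presheaf.stalk bB) ∈ (Ideal.span {g}).minimalPrimes := by
    rw [← hg]
    refine ⟨⟨inferInstance, hle⟩, fun q hq hqm => ?_⟩
    obtain ⟨hqprime, hKq⟩ := hq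
    -- the generisation `ζ` of `b_B` defined by `q` lies in `supp K`
    let ζ : B := B.fromSpecStalk bB ⟨q, hqprime⟩
    have hζspec : ζ ⤳ bB := fromSpecStalk_specializes ⟨q, hqprime⟩
    have hζK : ζ ∈ K.support := by
      rw [mem_support_iff_stalkIdeal_le_primeOfSpecializes hζspec K, primeOfSpecializes_fromSpecStalk]
      exact hKq
    -- so `i ζ ∈ supp J`, a point of `B`; hence `i ζ = b = i b_B` and `ζ = b_B`
    have hiζ : i.base ζ ∈ (J.support : Set _) := by
      have h := hζK
      change ζ ∈ (J.comap i).support at h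
      rw [Scheme.IdealSheafData.support_comap] at h
      exact h
    have hζeq : ζ = bB := by
      by_contra hne
      refine hoff (i.base ζ) ?_ ?_ hiζ
      · rw [hi]; exact P012_le_comap_factor k F hF _
      · intro heq
        apply hne
        apply i.isClosedEmbedding.injective
        apply PrimeSpectrum.ext
        rw [heq, hi, hbB, comap_factor_map'_span_X k F hF (Set.subset_univ _)]
    -- `ζ = b_B` is the image of the closed point only
    have hq' : (⟨q, hqprime⟩ : PrimeSpectrum (B.presheaf.stalk bB)) = closedPoint (B.presheaf.stalk bB) := by
      apply (B.fromSpecStalk bB).isEmbedding.injective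
      rw [Scheme.fromSpecStalk_closedPoint]
      exact hζeq
    have : q = maximalIdeal (B.presheaf.stalk bB) := congrArg PrimeSpectrum.asIdeal hq'
    rw [this]
  -- (3) Krull: `ht 𝔪 ≤ 1`
  haveI : (Ideal.span {g}).IsPrincipal := ⟨⟨g, rfl⟩⟩
  have h1 := Ideal.height_le_one_of_isPrincipal_of_mem_minimalPrimes (Ideal.span {g}) _ hmin
  -- (4) but `ht 𝔪 = dim 𝒪_{B,b_B} = ht 𝔮′_{01234} ≥ 2`
  have h2 : (2 : ℕ∞) ≤ (maximalIdeal (B.presheaf.stalk bB)).height := by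
    have hdim : ringKrullDim (B.presheaf.stalk bB) = bB.asIdeal.height := by
      rw [ringKrullDim_eq_of_ringEquiv (Spec.stalkIso (.of _) bB).commRingCatIsoToRingEquiv,
        IsLocalization.AtPrime.ringKrullDim_eq_height bB.asIdeal (Localization.AtPrime bB.asIdeal)]
    have h := IsLocalRing.maximalIdeal_height_eq_ringKrullDim (R := B.presheaf.stalk bB)
    rw [hdim] at h
    have h' : (maximalIdeal (B.presheaf.stalk bB)).height = bB.asIdeal.height := by exact_mod_cast h
    rw [h', hbB]
    exact two_le_height_origin_D' k
  have h21 : (2 : ℕ∞) ≤ 1 := h2.trans h1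
  exact absurd h21 (by decide)

end NonPrincipal

end Summit.ResolutionOfSingularities.ResolutionOfSingularities.Theorems.FInjectiveMacaulayfication.WildPinchCylinderAxis

end
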